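import Literature.MathematicalPhysics.QuantumLattice.SL2CPCTMatrix
import HarnessLib

/-!
# The PCT matrix of the complex-conjugate representation

Topic `Literature/MathematicalPhysics/QuantumLattice` (trunk T-AQFT), kinematics of the PCT theorem
(Streater–Wightman (1964), §4-3, Thm. 4-7). The adjoint components `φ_{(k,α)†}` of a spinor field
transform under the complex-conjugate representation `S̄ : A ↦ conj (S A)` (S–W §3-1). For the PCT
operator `Θ` (which maps components to adjoint components) and for the odd-Fermi-number vanishing
one needs the PCT matrix `SL2C.pctMatrix` of `S̄` in terms of that of `S`:

* `SL2C.gen_of_map_conj` — the generators of `S̄` are the conjugates of those of `S`;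
* `SL2C.boostIPi_of_map_conj` — the continued boost `e^{(iπ/2) Ȳ}` of `S̄` is the conjugate of
  `e^{−(iπ/2) Y}`, i.e. of `boostIPiInv S`;
* `SL2C.boostIPiInv_eq` — `boostIPiInv S = boostIPi S · S(−1)` (`e^{2πi Y}… = S(−1)`,
  `SL2C.exp_pi_mul_I_smul_genH`);
* `SL2C.pctMatrix_of_map_conj` — **`pctMatrix S̄ = conj (pctMatrix S · S(−1))`**.

## References

* R. F. Streater, A. S. Wightman, *PCT, Spin and Statistics, and All That* (1964; Princeton 2000),
  §3-1, §4-3 Thm. 4-7 eqs. (4-29)–(4-32). [StreaterWightman1964]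
-/

noncomputable section

open NormedSpace Filter Set Complex ComplexConjugate
open _root_.Topology
open scoped Matrix.Norms.Operator MatrixGroups Real

namespace Literature.MathematicalPhysics.QuantumLattice

namespace SL2C

variable {ι : Type*} [Fintype ι] [DecidableEq ι]
variable (S S' : SL(2, ℂ) →* Matrix ι ι ℂ)

/-- Entrywise complex conjugation of matrices as a ring homomorphism. [folklore] -/
abbrev conjMat : Matrix ι ι ℂ →+* Matrix ι ι ℂ := (starRingEnd ℂ).mapMatrix

/-- `conjMat M = M.map conj`. [folklore] -/
theorem conjMat_apply (M : Matrix ι ι ℂ) : conjMat M = M.map conj := rfl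

/-- Entrywise conjugation is continuous. [folklore] -/
theorem continuous_conjMat : Continuous (conjMat : Matrix ι ι ℂ → Matrix ι ι ℂ) :=
  continuous_id.matrix_map Complex.continuous_conj

/-- Conjugation of a scalar multiple: `conj (c • M) = conj c • conj M`. [folklore] -/
theorem conjMat_smul (c : ℂ) (M : Matrix ι ι ℂ) : conjMat (c • M) = conj c • conjMat M := by
  ext a b; simp

/-- Conjugation of a real scalar multiple. [folklore] -/
theorem conjMat_real_smul (t : ℝ) (M : Matrix ι ι ℂ) : conjMat (t • M) = t • conjMat M := by
  ext a b; simp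

/-- Conjugation commutes with the exponential. [folklore] -/
theorem conjMat_exp (M : Matrix ι ι ℂ) : conjMat (exp M) = exp (conjMat M) :=
  map_exp (conjMat : Matrix ι ι ℂ →+* Matrix ι ι ℂ) continuous_conjMat M

variable {S S'}

/-- **The generators of the conjugate representation are the conjugate generators.** [cite: StreaterWightman1964, §3-1] -/
theorem gen_of_map_conj (hS : Continuous S) (hS' : Continuous S') (hconj : ∀ A, S' A = conjMat (S A))
    {ξ : M2} (hξ : IsGen ξ) : gen S' hS' ξ hξ = conjMat (gen S hS ξ hξ) := by
  refine Literature.Analysis.OperatorTheory.generator_unique fun t => ?_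
  calc exp (t • gen S' hS' ξ hξ) = S' (toSL ξ hξ t) := (apply_toSL S' hS' hξ t).symm
    _ = conjMat (S (toSL ξ hξ t)) := hconj _
    _ = conjMat (exp (t • gen S hS ξ hξ)) := by rw [apply_toSL S hS hξ t]
    _ = exp (conjMat (t • gen S hS ξ hξ)) := conjMat_exp _
    _ = exp (t • conjMat (gen S hS ξ hξ)) := by rw [conjMat_real_smul]

/-- **The continued boost of the conjugate representation**: `boostIPi S̄ = conj (boostIPiInv S)`.
[cite: StreaterWightman1964, §4-3 eq. (4-29)] -/
theorem boostIPi_of_map_conj (hS : Continuous S) (hS' : Continuous S') (hconj : ∀ A, S' A = conjMat (S A)) :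
    boostIPi S' hS' = conjMat (boostIPiInv S hS) := by
  have hc : conj (-(((π : ℂ) / 2) * I)) = ((π : ℂ) / 2) * I := by
    rw [map_neg, map_mul, map_div₀, Complex.conj_ofReal, Complex.conj_I]
    simp [map_ofNat]
  calc boostIPi S' hS' = exp ((((π : ℂ) / 2) * I) • gen S' hS' hMat isGen_hMat) := rfl
    _ = exp ((((π : ℂ) / 2) * I) • conjMat (gen S hS hMat isGen_hMat)) := by rw [gen_of_map_conj hS hS' hconj]
    _ = exp (conjMat ((-(((π : ℂ) / 2) * I)) • gen S hS hMat isGen_hMat)) := by rw [conjMat_smul, hc]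
    _ = conjMat (exp ((-(((π : ℂ) / 2) * I)) • gen S hS hMat isGen_hMat)) := (conjMat_exp _).symm
    _ = conjMat (boostIPiInv S hS) := by rw [boostIPiInv, smul_neg, neg_smul]

/-- `boostIPi⁴ = 1`: `(e^{(iπ/2)Y})⁴ = e^{2πiY} = S(−1)² = 1`. [cite: StreaterWightman1964, §4-4 eq. (4-51)] -/
theorem boostIPi_pow_four [Nonempty ι] (hS : Continuous S) :
    boostIPi S hS * boostIPi S hS * (boostIPi S hS * boostIPi S hS) = 1 := by
  rw [boostIPi_mul_boostIPi, exp_pi_mul_I_smul_genH S hS, ← map_mul]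
  simp

/-- **`boostIPiInv S = boostIPi S · S(−1)`** (`e^{−(iπ/2)Y} = e^{(iπ/2)Y} e^{−iπY}` and
`e^{iπY} = S(−1)` is an involution). [cite: StreaterWightman1964, §4-4 eq. (4-51)] -/
theorem boostIPiInv_eq (hS : Continuous S) : boostIPiInv S hS = boostIPi S hS * S (-1) := by
  cases isEmpty_or_nonempty ι with
  | inl h => exact Subsingleton.elim _ _
  | inr h =>
    calc boostIPiInv S hS = boostIPiInv S hS * (boostIPi S hS * boostIPi S hS * (boostIPi S hS * boostIPi S hS)) := by
          rw [boostIPi_pow_four hS, mul_one]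
      _ = (boostIPiInv S hS * boostIPi S hS) * boostIPi S hS * (boostIPi S hS * boostIPi S hS) := by
          simp only [mul_assoc]
      _ = boostIPi S hS * S (-1) := by
          rw [boostIPiInv_mul_boostIPi, one_mul, boostIPi_mul_boostIPi, exp_pi_mul_I_smul_genH S hS]

/-- **The PCT matrix of the conjugate representation**: `pctMatrix S̄ = conj (pctMatrix S · S(−1))`.
[cite: StreaterWightman1964, §4-3 Thm 4-7] -/
theorem pctMatrix_of_map_conj (hS : Continuous S) (hS' : Continuous S') (hconj : ∀ A, S' A = conjMat (S A)) :
    pctMatrix S' hS' = conjMat (pctMatrix S hS * S (-1)) := by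
  rw [pctMatrix, pctMatrix, hconj, boostIPi_of_map_conj hS hS' hconj, ← map_mul, mul_assoc, ← boostIPiInv_eq hS]

/-- Entrywise form: `pctMatrix S̄ a b = conj ((pctMatrix S · S(−1)) a b)`. [cite: StreaterWightman1964, §4-3 Thm 4-7] -/
theorem pctMatrix_of_map_conj_apply (hS : Continuous S) (hS' : Continuous S') (hconj : ∀ A, S' A = conjMat (S A)) (a b : ι) :
    pctMatrix S' hS' a b = conj ((pctMatrix S hS * S (-1)) a b) := by
  rw [pctMatrix_of_map_conj hS hS' hconj]; rfl

end SL2C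

end Literature.MathematicalPhysics.QuantumLattice
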